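import Mathlib
import Literature.Analysis.Complex.Bieberbach

/-!
# Stub `helper_sigmaOmitted`: omitted values of a normalised univalent function near infinity

Stub `helper_sigmaOmitted` of line `Sketch` of the crux `SullivanDual.WitnessCharge`
(`stmt-SmoothPoincare4-7824`), proved with its registered statement verbatim: if `g` is holomorphic
and injective on `{R < ‖z‖}` (`R > 0`) with `g z - z → 0` as `z → ∞` (the class `Σ` with `b₀ = 0`,
rescaled to radius `R`), then every value `c` omitted by `g` on `{R < ‖z‖}` satisfies `‖c‖ ≤ 2R`
(Pommerenke, *Univalent Functions* (1975), Thm. 1.5; Duren, *Univalent Functions* (1983), §2.2: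
a consequence of Bieberbach's `|a₂| ≤ 2`).

Proof. Rescaling `g₁ ζ = R⁻¹ g (R ζ)` reduces to `R = 1`. For an omitted value `c`, the germ
`h z = g (1/z) - 1/z` (`h 0 = 0`) is holomorphic on the unit disc by Riemann's removable
singularity theorem (`Complex.differentiableOn_compl_singleton_and_continuousAt_iff`), the
denominator `D z = 1 + z (h z - c)` (`= z (g (1/z) - c)` for `z ≠ 0`) is zero-free on the disc with
`D 0 = 1`, `D' 0 = -c`, and `F z = z / D z = 1 / (g (1/z) - c)` belongs to the class `S`
(holomorphic, injective, `F 0 = 0`, `F' 0 = 1`). Since `dslope F 0 = 1/D` near `0`, its second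
coefficient is `(dslope F 0)'(0) = -D'(0) = c`, and Bieberbach's theorem
(`Literature.Analysis.Complex.AreaThm.norm_deriv_dslope_le_two`) gives `‖c‖ ≤ 2`.

Everything here is proved; no facts and no `Prop`-valued definitions are introduced.

## References

* Ch. Pommerenke, *Univalent Functions*, Vandenhoeck & Ruprecht (1975), Thm. 1.5.
* P. L. Duren, *Univalent Functions*, Springer (1983), §2.2.
-/

noncomputable section

set_option linter.dupNamespace false

open Filter Set Metric Topology Complex

namespace Summit.SmoothPoincare4.SmoothPoincare4.Theorems.WitnessCharge.PencilIncompleteness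

/-- Transport of the normalisation `g w - w → 0` (`w → ∞`) to the origin through `w = z⁻¹`:
`g z⁻¹ - z⁻¹ → 0` as `z → 0`, `z ≠ 0`. [folklore] -/
theorem helper_sigmaOmitted_tendsto_inv {g : ℂ → ℂ}
    (hg : Tendsto (fun z : ℂ => g z - z) (cocompact ℂ) (𝓝 0)) :
    Tendsto (fun z : ℂ => g z⁻¹ - z⁻¹) (𝓝[≠] 0) (𝓝 0) := by
  have h : Tendsto (fun z : ℂ => z⁻¹) (𝓝[≠] (0 : ℂ)) (cocompact ℂ) := by
    rw [← Metric.cobounded_eq_cocompact]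
    exact Filter.tendsto_inv₀_nhdsNE_zero
  exact hg.comp h

/-- The germ `h z = g z⁻¹ - z⁻¹`, extended by `h 0 = 0`, is holomorphic on the unit disc when `g` is
holomorphic on `{1 < ‖z‖}` with `g w - w → 0` at infinity (Riemann's removable singularity
theorem). [folklore] -/
theorem helper_sigmaOmitted_differentiableOn_update {g : ℂ → ℂ}
    (hd : DifferentiableOn ℂ g {z : ℂ | 1 < ‖z‖})
    (hg : Tendsto (fun z : ℂ => g z - z) (cocompact ℂ) (𝓝 0)) :
    DifferentiableOn ℂ (Function.update (fun z : ℂ => g z⁻¹ - z⁻¹) 0 0) (ball 0 1) := by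
  have h0 : ball (0 : ℂ) 1 ∈ 𝓝 (0 : ℂ) := isOpen_ball.mem_nhds (mem_ball_self one_pos)
  refine (Complex.differentiableOn_compl_singleton_and_continuousAt_iff h0).1 ⟨?_, ?_⟩
  · have hinv : DifferentiableOn ℂ (fun z : ℂ => z⁻¹) (ball (0 : ℂ) 1 \ {0}) :=
      differentiableOn_inv.mono fun z hz => hz.2
    have hmaps : MapsTo (fun z : ℂ => z⁻¹) (ball (0 : ℂ) 1 \ {0}) {z : ℂ | 1 < ‖z‖} := by
      intro z hz
      have hz0 : z ≠ 0 := hz.2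
      rw [mem_setOf_eq, norm_inv]
      exact (one_lt_inv₀ (norm_pos_iff.2 hz0)).2 (mem_ball_zero_iff.1 hz.1)
    have hcomp : DifferentiableOn ℂ (fun z : ℂ => g z⁻¹ - z⁻¹) (ball (0 : ℂ) 1 \ {0}) :=
      (hd.comp hinv hmaps).sub hinv
    refine hcomp.congr fun z hz => ?_
    have hz0 : z ≠ 0 := hz.2
    exact Function.update_of_ne hz0 _ _
  · exact continuousAt_update_same.2 (helper_sigmaOmitted_tendsto_inv hg)

/-- The Bieberbach step: if `D` is holomorphic and zero-free on the unit disc with `D 0 = 1`,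
`D' 0 = -c`, and `F z = z / D z` is injective on the disc, then `‖c‖ ≤ 2`. Indeed `F ∈ S` and
`dslope F 0 = 1/D` near `0`, so `a₂(F) = (dslope F 0)'(0) = -D'(0) = c` and Bieberbach's theorem
`|a₂| ≤ 2` applies. [folklore] -/
theorem helper_sigmaOmitted_bieberbach_step {D : ℂ → ℂ} {c : ℂ}
    (hDd : DifferentiableOn ℂ D (ball 0 1)) (hDne : ∀ z ∈ ball (0 : ℂ) 1, D z ≠ 0)
    (hD0 : D 0 = 1) (hDderiv : HasDerivAt D (-c) 0)
    (hinj : InjOn (fun z : ℂ => z / D z) (ball 0 1)) : ‖c‖ ≤ 2 := by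
  have hD0ne : D 0 ≠ 0 := by rw [hD0]; exact one_ne_zero
  have hFd : DifferentiableOn ℂ (fun z : ℂ => z / D z) (ball 0 1) :=
    differentiableOn_id.fun_div hDd hDne
  have hF0 : (fun z : ℂ => z / D z) 0 = 0 := by simp
  have hFderiv : HasDerivAt (fun z : ℂ => z / D z) 1 0 :=
    ((hasDerivAt_id' (0 : ℂ)).fun_div hDderiv hD0ne).congr_deriv (by simp [hD0])
  have hF1 : deriv (fun z : ℂ => z / D z) 0 = 1 := hFderiv.deriv
  have hB := Literature.Analysis.Complex.AreaThm.norm_deriv_dslope_le_two hFd hinj hF0 hF1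
  -- `dslope F 0 = 1/D`
  have hev : dslope (fun z : ℂ => z / D z) 0 = fun z => (D z)⁻¹ := by
    funext z
    by_cases hz0 : z = 0
    · rw [hz0, dslope_same, hF1, hD0, inv_one]
    · rw [dslope_of_ne _ hz0, slope_def_field]
      simp only [zero_div, sub_zero]
      rw [div_right_comm, div_self hz0, one_div]
  have hds : deriv (dslope (fun z : ℂ => z / D z) 0) 0 = c := by
    rw [hev, (hDderiv.fun_inv hD0ne).deriv, hD0]
    simp
  rw [hds] at hB
  exact hB

/-- The case `R = 1`: a function `g` holomorphic and injective on `{1 < ‖z‖}` with `g z - z → 0`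
at infinity omits only values `c` with `‖c‖ ≤ 2` (Pommerenke (1975), Thm. 1.5). With
`h z = g z⁻¹ - z⁻¹` (`h 0 = 0`) and `D z = 1 + z (h z - c)`, the function `z / D z = 1/(g z⁻¹ - c)`
is in `S` and the Bieberbach step applies. [folklore] -/
theorem helper_sigmaOmitted_one {g : ℂ → ℂ}
    (hd : DifferentiableOn ℂ g {z : ℂ | 1 < ‖z‖}) (hinj : InjOn g {z : ℂ | 1 < ‖z‖})
    (hg : Tendsto (fun z : ℂ => g z - z) (cocompact ℂ) (𝓝 0))
    {c : ℂ} (hc : c ∉ g '' {z : ℂ | 1 < ‖z‖}) : ‖c‖ ≤ 2 := by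
  have h0 : ball (0 : ℂ) 1 ∈ 𝓝 (0 : ℂ) := isOpen_ball.mem_nhds (mem_ball_self one_pos)
  -- points of the punctured disc invert into `{1 < ‖z‖}`, where `g ≠ c`
  have hinvmem : ∀ z ∈ ball (0 : ℂ) 1, z ≠ 0 → z⁻¹ ∈ {z : ℂ | 1 < ‖z‖} := fun z hz hz0 => by
    rw [mem_setOf_eq, norm_inv]
    exact (one_lt_inv₀ (norm_pos_iff.2 hz0)).2 (mem_ball_zero_iff.1 hz)
  have hgc : ∀ z ∈ ball (0 : ℂ) 1, z ≠ 0 → g z⁻¹ - c ≠ 0 := fun z hz hz0 heq =>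
    hc ⟨z⁻¹, hinvmem z hz hz0, sub_eq_zero.1 heq⟩
  -- the regular germ `h` and the denominator `D`
  obtain ⟨h, hh⟩ : ∃ h : ℂ → ℂ, h = Function.update (fun z : ℂ => g z⁻¹ - z⁻¹) 0 0 := ⟨_, rfl⟩
  have hhd : DifferentiableOn ℂ h (ball 0 1) := by
    rw [hh]; exact helper_sigmaOmitted_differentiableOn_update hd hg
  have hh0 : h 0 = 0 := by rw [hh]; exact Function.update_self _ _ _
  have hhz : ∀ z : ℂ, z ≠ 0 → h z = g z⁻¹ - z⁻¹ := fun z hz => by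
    rw [hh]; exact Function.update_of_ne hz _ _
  obtain ⟨D, hD⟩ : ∃ D : ℂ → ℂ, D = fun z => 1 + z * (h z - c) := ⟨_, rfl⟩
  have hDapply : ∀ z : ℂ, D z = 1 + z * (h z - c) := fun z => congrFun hD z
  have hDz : ∀ z : ℂ, z ≠ 0 → D z = z * (g z⁻¹ - c) := fun z hz => by
    rw [hDapply, hhz z hz]
    linear_combination (-1 : ℂ) * mul_inv_cancel₀ hz
  have hD0 : D 0 = 1 := by rw [hDapply]; ring
  have hDne : ∀ z ∈ ball (0 : ℂ) 1, D z ≠ 0 := fun z hz => by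
    by_cases hz0 : z = 0
    · rw [hz0, hD0]; exact one_ne_zero
    · rw [hDz z hz0]; exact mul_ne_zero hz0 (hgc z hz hz0)
  have hDd : DifferentiableOn ℂ D (ball 0 1) := by
    rw [hD]
    exact (differentiableOn_const (1 : ℂ)).add (differentiableOn_id.fun_mul (hhd.sub_const c))
  have hDderiv : HasDerivAt D (-c) 0 := by
    have hh' : HasDerivAt h (deriv h 0) 0 := (hhd.differentiableAt h0).hasDerivAt
    rw [hD]
    exact (((hasDerivAt_id' (0 : ℂ)).fun_mul (hh'.sub_const c)).const_add (1 : ℂ)).congr_deriv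
      (by simp [hh0])
  -- `z / D z = 1/(g z⁻¹ - c)` off the origin; injectivity
  have hFz : ∀ z : ℂ, z ≠ 0 → z / D z = (g z⁻¹ - c)⁻¹ := fun z hz0 => by
    rw [hDz z hz0, ← div_div, div_self hz0, one_div]
  have hFinj : InjOn (fun z : ℂ => z / D z) (ball 0 1) := by
    intro z₁ hz₁ z₂ hz₂ heq'
    have heq : z₁ / D z₁ = z₂ / D z₂ := heq'
    by_cases h₁ : z₁ = 0
    · subst h₁
      rw [zero_div, eq_comm, div_eq_zero_iff] at heq
      exact (heq.resolve_right (hDne z₂ hz₂)).symm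
    by_cases h₂ : z₂ = 0
    · subst h₂
      rw [zero_div, div_eq_zero_iff] at heq
      exact absurd (heq.resolve_right (hDne z₁ hz₁)) h₁
    rw [hFz z₁ h₁, hFz z₂ h₂, inv_inj, sub_left_inj] at heq
    exact inv_injective (hinj (hinvmem z₁ hz₁ h₁) (hinvmem z₂ hz₂ h₂) heq)
  exact helper_sigmaOmitted_bieberbach_step hDd hDne hD0 hDderiv hFinj

/-- **Stub `helper_sigmaOmitted`** (Pommerenke, *Univalent Functions* (1975), Thm. 1.5; Duren (1983),
§2.2): a function `g` holomorphic and injective on `{R < ‖z‖}` (`R > 0`) with `g z - z → 0` at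
infinity omits only values in the closed disc `‖c‖ ≤ 2R`. Reduced to `R = 1`
(`helper_sigmaOmitted_one`) by the rescaling `g₁ ζ = R⁻¹ g (R ζ)`, which omits `R⁻¹ c`. [folklore] -/
theorem helper_sigmaOmitted :
    ∀ (R : ℝ), 0 < R → ∀ (g : ℂ → ℂ),
      DifferentiableOn ℂ g {z : ℂ | R < ‖z‖} → Set.InjOn g {z : ℂ | R < ‖z‖} →
      Tendsto (fun z : ℂ => g z - z) (cocompact ℂ) (𝓝 0) →
      ∀ c : ℂ, c ∉ g '' {z : ℂ | R < ‖z‖} → ‖c‖ ≤ 2 * R := by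
  intro R hR g hd hinj hg c hc
  have hR0 : (R : ℂ) ≠ 0 := ofReal_ne_zero.2 hR.ne'
  have hnR : ‖(R : ℂ)‖ = R := Complex.norm_of_nonneg hR.le
  -- the rescaling `ζ ↦ R ζ` maps `{1 < ‖ζ‖}` into `{R < ‖z‖}` and tends to infinity at infinity
  have hmaps : MapsTo (fun ζ : ℂ => (R : ℂ) * ζ) {ζ : ℂ | 1 < ‖ζ‖} {z : ℂ | R < ‖z‖} := by
    intro ζ hζ
    have hζ' : 1 < ‖ζ‖ := hζ
    show R < ‖(R : ℂ) * ζ‖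
    rw [norm_mul, hnR]
    exact lt_mul_of_one_lt_right hR hζ'
  have hsc : Tendsto (fun ζ : ℂ => (R : ℂ) * ζ) (cocompact ℂ) (cocompact ℂ) := by
    rw [← Metric.cobounded_eq_cocompact]
    exact Filter.tendsto_mul_left_cobounded hR0
  -- the rescaled function `g₁ ζ = R⁻¹ g (R ζ)` is in the class `Σ` (`b₀ = 0`) on `{1 < ‖ζ‖}`
  have hlin : DifferentiableOn ℂ (fun ζ : ℂ => (R : ℂ) * ζ) {ζ : ℂ | 1 < ‖ζ‖} := by fun_prop
  have hd₁ : DifferentiableOn ℂ (fun ζ : ℂ => (R : ℂ)⁻¹ * g ((R : ℂ) * ζ)) {ζ : ℂ | 1 < ‖ζ‖} :=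
    (hd.comp hlin hmaps).const_mul _
  have hinj₁ : InjOn (fun ζ : ℂ => (R : ℂ)⁻¹ * g ((R : ℂ) * ζ)) {ζ : ℂ | 1 < ‖ζ‖} := by
    intro ζ₁ h₁ ζ₂ h₂ heq'
    have heq : (R : ℂ)⁻¹ * g ((R : ℂ) * ζ₁) = (R : ℂ)⁻¹ * g ((R : ℂ) * ζ₂) := heq'
    have hRζ : (R : ℂ) * ζ₁ = (R : ℂ) * ζ₂ :=
      hinj (hmaps h₁) (hmaps h₂) (mul_left_cancel₀ (inv_ne_zero hR0) heq)
    exact mul_left_cancel₀ hR0 hRζ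
  have hg₁ : Tendsto (fun ζ : ℂ => (R : ℂ)⁻¹ * g ((R : ℂ) * ζ) - ζ) (cocompact ℂ) (𝓝 0) := by
    have h2 := (hg.comp hsc).const_mul (R : ℂ)⁻¹
    rw [mul_zero] at h2
    refine h2.congr fun ζ => ?_
    simp only [Function.comp_apply]
    rw [mul_sub, ← mul_assoc _ (R : ℂ) ζ, inv_mul_cancel₀ hR0, one_mul]
  -- and omits `R⁻¹ c`
  have hc₁ : (R : ℂ)⁻¹ * c ∉ (fun ζ : ℂ => (R : ℂ)⁻¹ * g ((R : ℂ) * ζ)) '' {ζ : ℂ | 1 < ‖ζ‖} := by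
    rintro ⟨ζ, hζ, hζc'⟩
    have hζc : (R : ℂ)⁻¹ * g ((R : ℂ) * ζ) = (R : ℂ)⁻¹ * c := hζc'
    exact hc ⟨(R : ℂ) * ζ, hmaps hζ, mul_left_cancel₀ (inv_ne_zero hR0) hζc⟩
  have h := helper_sigmaOmitted_one hd₁ hinj₁ hg₁ hc₁
  rw [norm_mul, norm_inv, hnR, inv_mul_le_iff₀ hR] at h
  linarith

end Summit.SmoothPoincare4.SmoothPoincare4.Theorems.WitnessCharge.PencilIncompleteness
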